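import Summits.Ventures.HodgeRepro2.Defs

/-!
# Dichotomy.lean — a rank-four face contains either no conjugate pair or two (any degree)

Seat p1 (gen 2) of the blind cell pub-hodge-repro2.  Sextic.lean proves the census of TIER3 §5(g)
for three conjugate pairs (8 = 2 tetrahedra + 6 unions of two conjugate pairs).  TIER3 §6 item 13
says "Liu's statements hold for every d …, so nothing changes for general g"; for the FACES this
needs a caveat: for `g = 4` conjugate pairs there are 52 balanced 4-sets, of which 28 are unions of
two conjugate pairs and 24 contain no conjugate pair at all (`card_cubeBalancedSets₄` below, kernel
count), so "parity tetrahedron" is the `g = 3` instance of the second kind.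

What holds in every degree is the **dichotomy** `isWeilFace_conjClosed_of_exists_conj`: if a
rank-four face with four distinct vertices contains one conjugate pair `{Φ, Φ̄}`, then it is a union
of two conjugate pairs `{Φ, Φ̄, Φ′, Φ̄′}` (Deligne LNM 900 Prop. 4.4 balance: `σ` lies in exactly
one of `Φ, Φ̄`, hence in exactly one of the other two vertices, which are therefore complementary).
Consequently every rank-four face with distinct vertices is either a union of two conjugate pairs
(whose Weil classes are products of Lefschetz `(1,1)`-classes, §5(g)) or contains NO conjugate
pair — the only faces the closer has to handle.
-/

namespace Summit.Ventures.HodgeRepro2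

open NumberField

section Dichotomy

variable {K : Type*} [Field K]

/-- For a CM type, the conjugate type is the complement. -/
theorem mem_conjCMType_iff_notMem {Φ : Set (K →+* ℂ)} (hΦ : IsCMType K Φ) (φ : K →+* ℂ) :
    φ ∈ conjCMType K Φ ↔ φ ∉ Φ := by
  show ComplexEmbedding.conjugate φ ∈ Φ ↔ φ ∉ Φ
  rcases hΦ φ with ⟨h1, h2⟩ | ⟨h1, h2⟩
  · exact ⟨fun h => absurd h h2, fun h => absurd h1 h⟩
  · exact ⟨fun _ => h2, fun _ => h1⟩

open Classical in
/-- In a rank-four face, the set of vertices containing `φ` has two elements, as a `Finset`. -/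
theorem IsWeilFace.card_filter_eq_two {T : Fin 4 → Set (K →+* ℂ)} (hT : IsWeilFace K T)
    (φ : K →+* ℂ) : (Finset.univ.filter fun i => φ ∈ T i).card = 2 := by
  have := hT.2 φ
  rwa [Nat.card_eq_fintype_card, Fintype.card_subtype] at this

/-- **Dichotomy**: a rank-four face with four distinct vertices that contains one conjugate pair
`T j = conj (T i)` is closed under conjugation — the remaining two vertices are conjugate to each
other. -/
theorem isWeilFace_conjClosed_of_exists_conj {T : Fin 4 → Set (K →+* ℂ)} (hT : IsWeilFace K T)
    (hinj : Function.Injective T) {i j : Fin 4} (hij : T j = conjCMType K (T i)) :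
    ∀ k, ∃ l, T l = conjCMType K (T k) := by
  classical
  -- there is at least one embedding, else all four vertices would be the empty set
  have hnon : Nonempty (K →+* ℂ) := by
    have h01 : ¬ ∀ x, x ∈ T 0 ↔ x ∈ T 1 := fun h =>
      (by decide : (0 : Fin 4) ≠ 1) (hinj (Set.ext h))
    obtain ⟨φ, _⟩ := not_forall.mp h01
    exact ⟨φ⟩
  have hne : i ≠ j := by
    intro h
    subst h
    -- `T i = conj (T i)` is impossible: a CM type is not its own complement
    obtain ⟨φ⟩ := hnon
    have hmem := (mem_conjCMType_iff_notMem (hT.1 i) φ)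
    rw [← hij] at hmem
    exact hmem.mp (hmem.mpr (fun h => hmem.mp h h)) (hmem.mpr (fun h => hmem.mp h h))
  -- for each `φ`, exactly one of `T i`, `T j` contains `φ`, hence exactly one of the other two
  have key : ∀ k, k ≠ i → k ≠ j → ∀ l, l ≠ i → l ≠ j → k ≠ l →
      ∀ φ, φ ∈ T l ↔ φ ∉ T k := by
    intro k hki hkj l hli hlj hkl φ
    have hcard := hT.card_filter_eq_two φ
    have hxor : Xor (φ ∈ T i) (φ ∈ T j) := by
      rw [hij, mem_conjCMType_iff_notMem (hT.1 i)]
      by_cases h : φ ∈ T i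
      · exact Or.inl ⟨h, not_not.mpr h⟩
      · exact Or.inr ⟨h, h⟩
    -- the four indices are `i, j, k, l`
    have huniv : (Finset.univ : Finset (Fin 4)) = {i, j, k, l} := by
      symm
      apply Finset.eq_univ_of_card
      have h1 : i ∉ ({j, k, l} : Finset (Fin 4)) := by simp [hne, hki.symm, hli.symm]
      have h2 : j ∉ ({k, l} : Finset (Fin 4)) := by simp [hkj.symm, hlj.symm]
      rw [Finset.card_insert_of_notMem h1, Finset.card_insert_of_notMem h2, Finset.card_pair hkl,
        Fintype.card_fin]
    rw [huniv] at hcard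
    -- count the members of `{i, j, k, l}` containing `φ`
    rw [Finset.filter_insert, Finset.filter_insert, Finset.filter_insert, Finset.filter_singleton]
      at hcard
    rcases hxor with ⟨hi, hj⟩ | ⟨hj, hi⟩
    · rw [if_pos hi, if_neg hj] at hcard
      by_cases hk : φ ∈ T k
      · rw [if_pos hk] at hcard
        refine ⟨fun hl => ?_, fun h => absurd hk h⟩
        rw [if_pos hl, Finset.card_insert_of_notMem, Finset.card_insert_of_notMem,
          Finset.card_singleton] at hcard
        · omega
        · simp [hkl]
        · simp [hki.symm, hli.symm]
      · rw [if_neg hk] at hcard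
        refine ⟨fun _ => hk, fun _ => ?_⟩
        by_contra hl
        rw [if_neg hl] at hcard
        simp at hcard
    · rw [if_neg hi, if_pos hj] at hcard
      by_cases hk : φ ∈ T k
      · rw [if_pos hk] at hcard
        refine ⟨fun hl => ?_, fun h => absurd hk h⟩
        rw [if_pos hl, Finset.card_insert_of_notMem, Finset.card_insert_of_notMem,
          Finset.card_singleton] at hcard
        · omega
        · simp [hkl]
        · simp [hkj.symm, hlj.symm]
      · rw [if_neg hk] at hcard
        refine ⟨fun _ => hk, fun _ => ?_⟩
        by_contra hl
        rw [if_neg hl] at hcard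
        simp at hcard
  -- the two remaining indices
  have hex : ∀ i j : Fin 4, i ≠ j → ∃ k l : Fin 4, k ≠ i ∧ k ≠ j ∧ l ≠ i ∧ l ≠ j ∧ k ≠ l := by
    decide
  obtain ⟨k, l, hki, hkj, hli, hlj, hkl⟩ := hex i j hne
  have hlk : T l = conjCMType K (T k) := by
    ext φ
    rw [mem_conjCMType_iff_notMem (hT.1 k)]
    exact key k hki hkj l hli hlj hkl φ
  have hkl' : T k = conjCMType K (T l) := by
    ext φ
    rw [mem_conjCMType_iff_notMem (hT.1 l), hlk, mem_conjCMType_iff_notMem (hT.1 k), not_not]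
  have hji : T i = conjCMType K (T j) := by
    ext φ
    rw [mem_conjCMType_iff_notMem (hT.1 j), hij, mem_conjCMType_iff_notMem (hT.1 i), not_not]
  intro m
  by_cases hmi : m = i
  · exact ⟨j, hmi ▸ hij⟩
  by_cases hmj : m = j
  · exact ⟨i, hmj ▸ hji⟩
  by_cases hmk : m = k
  · exact ⟨l, hmk ▸ hlk⟩
  have hlast : ∀ m i j k l : Fin 4, i ≠ j → k ≠ i → k ≠ j → l ≠ i → l ≠ j → k ≠ l →
      m ≠ i → m ≠ j → m ≠ k → m = l := by
    decide
  have hml : m = l := hlast m i j k l hne hki hkj hli hlj hkl hmi hmj hmk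
  exact ⟨k, hml ▸ hkl'⟩

end Dichotomy

/-! ## The census for four conjugate pairs (degree 8), kernel-counted -/

/-- Balance for a set of vertices of the 4-cube. -/
def IsCubeBalancedSet₄ (S : Finset (Fin 4 → Bool)) : Prop :=
  S.card = 4 ∧ ∀ ν : Fin 4, (S.filter fun s => s ν = true).card = 2

/-- Balance in the 4-cube is decidable. -/
instance : DecidablePred IsCubeBalancedSet₄ := fun S => by unfold IsCubeBalancedSet₄; infer_instance

/-- **Degree 8**: there are 52 balanced 4-sets of vertices of the 4-cube. -/
theorem card_cubeBalancedSets₄ :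
    ((Finset.univ : Finset (Fin 4 → Bool)).powersetCard 4 |>.filter IsCubeBalancedSet₄).card = 52 := by
  decide +kernel

/-- Of these, 28 = `C(8,2)` are unions of two conjugate pairs … -/
theorem card_cubeBalancedSets₄_conjClosed :
    ((Finset.univ : Finset (Fin 4 → Bool)).powersetCard 4 |>.filter fun S =>
      IsCubeBalancedSet₄ S ∧ ∀ s ∈ S, (fun ν => !s ν) ∈ S).card = 28 := by
  decide +kernel

/-- … and 24 contain no conjugate pair at all (the `g = 4` analogue of the parity tetrahedra). -/
theorem card_cubeBalancedSets₄_noConjPair :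
    ((Finset.univ : Finset (Fin 4 → Bool)).powersetCard 4 |>.filter fun S =>
      IsCubeBalancedSet₄ S ∧ ∀ s ∈ S, (fun ν => !s ν) ∉ S).card = 24 := by
  decide +kernel

end Summit.Ventures.HodgeRepro2
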